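import Summits.CriticalPhenomena.Ising3DConformalLimit.Theorems.PerfectScreeningMixedSpectralRepresentationTorus
import Literature.Probability.LatticeModels.CriticalTwoPointBounds
import Literature.Probability.LatticeModels.CriticalTwoPointLower

/-!
# The mixed spectral representation of the critical two-point function of the 3D Ising model
(route `PerfectScreening`, support item `MixedSpectralRepresentation`, file 2/2 — closes the item)

Route `PerfectScreening` of `CriticalPhenomena / Ising3DConformalLimit`, support item
`stmt-CriticalPhenomena-13893` (`MixedSpectralRepresentation`): for every finitely supported real
`v` on the transverse plane `ℤ²` (support `s`), the axial form
`Q_v(n) := ∑_{x,y ∈ s} v_x v_y G((n, x − y))`, `G = ⟨σ₀σ_·⟩⁺_{β_c(3)} = criticalTwoPoint 3`, is a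
Hausdorff moment sequence on `[0, 1]`: `Q_v(n) = ∫ λ^{|n|} dμ_v(λ)`, `μ_v ≥ 0` finite — Aizenman–
Duminil-Copin 2021, Prop. 5.3 / App. Prop. 8.6 (arXiv Prop. 8.6), quadratic-form version.

## Proof

The printed proof (App. §8.3: transfer matrix on periodic tubes, positivity, `ℓ → ∞` by the
moment criterion), organised exactly as the tree's proof of the axis case
(`AizenmanDuminilCopin2021_prop_8_6_holds`):

* finite volume (file 1/2, `MixedSpectral.exists_torusFormMeasure`): on the torus `(ℤ/Nℤ)^{d'+1}`
  the axis form of the periodic two-point function is `∫ λⁿ dν_N`, `0 ≤ n < N`, for a positive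
  measure `ν_N` on `[0, ∞)` with `ν_N([0, δ]) ≤ B δ²` uniformly in `N`;
* the limit `N → ∞` (`MixedSpectral.exists_hausdorffMeasure_axisForm_of_sum_abs_le`): for
  `m*(β) = 0` the periodic two-point function converges to `⟨σ₀σ_x⟩⁺_β` (`tendsto_torusAxisForm`,
  ADC Prop. 5.2), and the tree's moment / weak-compactness lemma
  `AxisSpectral.exists_laplace_of_momentLimit` produces the Laplace representation
  `W(n) = ∫ e^{-an} dμ(a)` of the infinite-volume form `W = axisForm β i c x` when `∑_a |c_a| ≤ 1`
  (so that all moments are `≤ 1`); the normalisation is removed by homogeneity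
  (`MixedSpectral.exists_hausdorffMeasure_axisForm`) and the change of variables `λ = e^{-a}`
  gives a measure on `[0, 1]`;
* the item (`mixedSpectralRepresentation_proof`): `d' + 1 = 3`, `β = β_c(3)` where `m*(β_c) = 0`
  (`spontaneousMagnetization_criticalBeta_eq_zero_holds`, ADS 2015) and `β_c > 0`
  (`criticalBeta_pos_holds`), axis `i = 0`, sites `(0, x)`, `x ∈ s`; negative `n` by the evenness
  `G(-z) = G(z)` and the symmetry of the double sum.

References: M. Aizenman, H. Duminil-Copin, Ann. of Math. 194 (2021) = arXiv:1912.07973, §5.3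
Prop. 5.3, Prop. 5.2 and Appendix §8.3 Prop. 8.6 with its proof; J. Glimm, A. Jaffe,
*Quantum Physics* (1987) §6.1.
-/

noncomputable section

namespace Summit.CriticalPhenomena.Ising3DConformalLimit.Theorems

namespace MixedSpectral

open Finset _root_.MeasureTheory _root_.Filter
open scoped _root_.Topology _root_.NNReal
open Literature.Probability.LatticeModels

/-! ### Part 3. The infinite-volume limit -/

/-- `|⟨σ_u σ_w⟩_{𝕋_N;β,0}| ≤ 1` for the periodic two-point function. [folklore] -/
theorem abs_isingTorusTwoPoint_le_one {d N : ℕ} [NeZero N] (β : ℝ) (u w : TorusSite d N) :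
    |isingTorusTwoPoint d N β 0 u w| ≤ 1 := by
  rw [isingTorusTwoPoint]
  exact abs_isingTwoPoint_le_one _ _ _ _ _ _ _

/-- Axis forms of the periodic two-point function are bounded by `(∑_a |c_a|)²` (`|⟨σσ⟩| ≤ 1`). [folklore] -/
theorem abs_torusAxisForm_le {d' N : ℕ} [NeZero N] (β : ℝ) (i : Fin (d' + 1)) {ι : Type*} [Fintype ι]
    (c : ι → ℝ) (x : ι → TorusSite (d' + 1) N) (n : ZMod N) :
    |torusAxisForm β i c x n| ≤ (∑ a, |c a|) ^ 2 := by
  have hT : ∀ a b, |c a * c b * isingTorusTwoPoint (d' + 1) N β 0 (x a) (x b + Pi.single i n)| ≤ |c a| * |c b| := by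
    intro a b
    rw [abs_mul, abs_mul]
    exact mul_le_of_le_one_right (mul_nonneg (abs_nonneg _) (abs_nonneg _))
      (abs_isingTorusTwoPoint_le_one β _ _)
  rw [torusAxisForm, sq, Finset.sum_mul_sum]
  refine (Finset.abs_sum_le_sum_abs _ _).trans (Finset.sum_le_sum fun a _ => ?_)
  exact (Finset.abs_sum_le_sum_abs _ _).trans (Finset.sum_le_sum fun b _ => hT a b)

/-- **The spectral representation of a NORMALISED axis form** (ADC 2021 Prop. 5.3 / Prop. 8.6 for
a finitely supported real `v` with `‖v‖₁ ≤ 1`): for the nearest-neighbour Ising model on `ℤ^{d'+1}`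
at `β > 0` with `m*(β) = 0`, coefficients `c_a` with `∑_a |c_a| ≤ 1` at sites `x_a` of the
hyperplane `{x_i = 0}`, the form `W(n) = ∑_{a,b} c_a c_b ⟨σ₀ σ_{x_b - x_a + n e_i}⟩⁺_β` is the moment
sequence of a finite positive measure on `[0, 1]`.
[cite: AizenmanDuminilCopinAnnals2021, Appendix §8.3 Prop. 8.6 (= Prop. 5.3) and its proof] -/
theorem exists_hausdorffMeasure_axisForm_of_sum_abs_le {d' : ℕ} {β : ℝ} (hβ : 0 < β)
    (hm : spontaneousMagnetization (d' + 1) β = 0) (i : Fin (d' + 1)) {ι : Type*} [Fintype ι]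
    (c : ι → ℝ) (hc : ∑ a, |c a| ≤ 1) (x : ι → Site (d' + 1)) (hx : ∀ a, x a i = 0) :
    ∃ μ : Measure ℝ, IsFiniteMeasure μ ∧ μ (Set.Icc (0 : ℝ) 1)ᶜ = 0 ∧
      ∀ n : ℕ, axisForm β i c x n = ∫ t, t ^ n ∂μ := by
  classical
  obtain ⟨B, hB0, hB⟩ := exists_torusFormMeasure hβ d' c
  have hproj : ∀ (j : ℕ) (a : ι), Torus.proj (j + 3) (x a) i = 0 := fun j a => by simp [hx a]
  have hex : ∀ j : ℕ, ∃ ν : Measure ℝ, IsFiniteMeasure ν ∧ ν (Set.Iio 0) = 0 ∧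
      (∀ n : ℕ, Integrable (fun t : ℝ => t ^ n) ν) ∧
      (∀ n : ℕ, n < j + 3 → ∫ t, t ^ n ∂ν =
        torusAxisForm (N := j + 3) β i c (fun a => Torus.proj (j + 3) (x a)) ((n : ℕ) : ZMod (j + 3))) ∧
      ∀ δ : ℝ, 0 ≤ δ → ν (Set.Icc 0 δ) ≤ ENNReal.ofReal (B * δ ^ 2) :=
    fun j => hB (j + 3) (by omega) i (fun a => Torus.proj (j + 3) (x a)) (hproj j)
  choose ν hfin hsupp hint hmom hzero using hex
  set u : ℕ → ℝ := fun n => axisForm β i c x n with hu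
  have hlim : ∀ n, Tendsto (fun j => ∫ t, t ^ n ∂(ν j)) atTop (𝓝 (u n)) := by
    intro n
    refine (tendsto_torusAxisForm hβ.le hm i c x n).congr' ?_
    rw [EventuallyEq, eventually_atTop]
    exact ⟨n, fun j hj => (hmom j n (by omega)).symm⟩
  have hc1 : (∑ a, |c a|) ^ 2 ≤ 1 := by
    have h0 : 0 ≤ ∑ a, |c a| := Finset.sum_nonneg fun a _ => abs_nonneg _
    nlinarith
  have hle : ∀ j n, n ≤ j → ∫ t, t ^ n ∂(ν j) ≤ 1 := fun j n hnj => by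
    rw [hmom j n (by omega)]
    exact ((le_abs_self _).trans (abs_torusAxisForm_le _ _ _ _ _)).trans hc1
  obtain ⟨μ, hμfin, hμsupp, hμ⟩ :=
    AxisSpectral.exists_laplace_of_momentLimit u ν hfin hB0 hsupp hint hle hlim hzero
  -- change of variables `λ = e^{-a} ∈ (0, 1]`
  have hf : Measurable fun a : ℝ => Real.exp (-a) := Real.measurable_exp.comp measurable_neg
  refine ⟨μ.map fun a => Real.exp (-a), inferInstance, ?_, fun n => ?_⟩
  · rw [Measure.map_apply hf (measurableSet_Icc.compl)]
    refine measure_mono_null (fun a ha => ?_) hμsupp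
    simp only [Set.mem_preimage, Set.mem_compl_iff, Set.mem_Icc, not_and, not_le, Set.mem_Ici] at ha ⊢
    have h1 : 1 < Real.exp (-a) := ha (Real.exp_pos _).le
    by_contra hle'
    have : Real.exp (-a) ≤ 1 := Real.exp_le_one_iff.mpr (by linarith [not_lt.mp hle'])
    linarith
  · rw [integral_map hf.aemeasurable (continuous_pow n).aestronglyMeasurable]
    change u n = _
    rw [hμ n]
    refine integral_congr_ae (Eventually.of_forall fun a => ?_)
    show Real.exp (-(a * n)) = Real.exp (-a) ^ n
    rw [← Real.exp_nat_mul]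
    ring_nf

/-- **The spectral representation of an axis form** (ADC 2021 Prop. 5.3 / App. Prop. 8.6 for a
finitely supported real `v`, nearest-neighbour Ising model, `m*(β) = 0`): for `β > 0` with
`m*(β) = 0`, real coefficients `c_a` at sites `x_a` of the hyperplane `{x_i = 0}`, there is a finite
positive measure `μ` on `[0, 1]` with `∑_{a,b} c_a c_b ⟨σ₀ σ_{x_b - x_a + n e_i}⟩⁺_β = ∫ λⁿ dμ` for
all `n ∈ ℕ`. From the normalised case by homogeneity of degree two in `c`.
[cite: AizenmanDuminilCopinAnnals2021, Appendix §8.3 Prop. 8.6 (= Prop. 5.3) and its proof] -/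
theorem exists_hausdorffMeasure_axisForm {d' : ℕ} {β : ℝ} (hβ : 0 < β)
    (hm : spontaneousMagnetization (d' + 1) β = 0) (i : Fin (d' + 1)) {ι : Type*} [Fintype ι]
    (c : ι → ℝ) (x : ι → Site (d' + 1)) (hx : ∀ a, x a i = 0) :
    ∃ μ : Measure ℝ, IsFiniteMeasure μ ∧ μ (Set.Icc (0 : ℝ) 1)ᶜ = 0 ∧
      ∀ n : ℕ, axisForm β i c x n = ∫ t, t ^ n ∂μ := by
  set L : ℝ := ∑ a, |c a| + 1 with hL
  have hL0 : 0 < L := by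
    have : 0 ≤ ∑ a, |c a| := Finset.sum_nonneg fun a _ => abs_nonneg _
    linarith
  set c' : ι → ℝ := fun a => c a / L with hc'
  have hsum : ∑ a, |c' a| = (∑ a, |c a|) / L := by
    simp only [hc', abs_div, abs_of_pos hL0, Finset.sum_div]
  have hc'1 : ∑ a, |c' a| ≤ 1 := by
    rw [hsum, div_le_one hL0]
    linarith
  obtain ⟨μ, hfin, hsupp, hmom⟩ := exists_hausdorffMeasure_axisForm_of_sum_abs_le hβ hm i c' hc'1 x hx
  set r : ℝ≥0 := ⟨L ^ 2, by positivity⟩ with hr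
  refine ⟨r • μ, inferInstance, ?_, fun n => ?_⟩
  · rw [Measure.smul_apply, hsupp, smul_zero]
  · rw [integral_smul_nnreal_measure, ← hmom n]
    have hscale : axisForm β i c x n = L ^ 2 * axisForm β i c' x n := by
      unfold axisForm
      rw [Finset.mul_sum]
      refine Finset.sum_congr rfl fun a _ => ?_
      rw [Finset.mul_sum]
      refine Finset.sum_congr rfl fun b _ => ?_
      simp only [hc']
      field_simp
    rw [hscale]
    rfl

/-! ### Part 4. The quadratic form of the item: sites `(0, x)`, `x` in the transverse plane -/

/-- The translate `(0, b) - (0, a) + n e₀ = (n, b - a)` in `ℤ × ℤ^{d'}`. [folklore] -/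
theorem cons_zero_sub_cons_zero_add_single {d' : ℕ} (n : ℤ) (a b : Fin d' → ℤ) :
    ((Fin.cons 0 b : Site (d' + 1)) - Fin.cons 0 a + Pi.single 0 n : Site (d' + 1)) = Fin.cons n (b - a) := by
  funext j
  refine Fin.cases ?_ (fun j => ?_) j
  · simp
  · simp [Fin.succ_ne_zero]

/-- Negation of a site written in cons form: `-(n, z) = (-n, -z)`. [folklore] -/
theorem neg_cons {d' : ℕ} (n : ℤ) (z : Fin d' → ℤ) :
    (-(Fin.cons n z : Site (d' + 1)) : Site (d' + 1)) = Fin.cons (-n) (-z) := by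
  funext j
  refine Fin.cases ?_ (fun j => ?_) j
  · simp
  · simp

/-- **The mixed (axial × transverse) spectral representation, quadratic-form version** (ADC 2021
Prop. 5.3 / App. Prop. 8.6 for a finitely supported real `v` on the transverse hyperplane,
nearest-neighbour Ising model on `ℤ^{d'+1}`, `β > 0`, `m*(β) = 0`): for every finite
`s ⊆ ℤ^{d'}` and real `v` there is a finite positive measure `μ` on `[0, 1]` with
`∑_{x,y ∈ s} v_x v_y ⟨σ₀ σ_{(n, x - y)}⟩⁺_β = ∫ λ^{|n|} dμ` for all `n ∈ ℤ`. The case `n ≥ 0` is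
`exists_hausdorffMeasure_axisForm` at the sites `(0, x)`; negative `n` by the evenness
`⟨σ₀σ_{-z}⟩⁺ = ⟨σ₀σ_z⟩⁺` and the symmetry of the double sum.
[cite: AizenmanDuminilCopinAnnals2021, Appendix §8.3 Prop. 8.6 (= Prop. 5.3) and its proof] -/
theorem exists_hausdorffMeasure_consForm {d' : ℕ} {β : ℝ} (hβ : 0 < β)
    (hm : spontaneousMagnetization (d' + 1) β = 0) (s : Finset (Fin d' → ℤ)) (v : (Fin d' → ℤ) → ℝ) :
    ∃ μ : Measure ℝ, IsFiniteMeasure μ ∧ μ (Set.Icc (0 : ℝ) 1)ᶜ = 0 ∧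
      ∀ n : ℤ, ∑ x ∈ s, ∑ y ∈ s, v x * v y * twoPointPlus (d' + 1) β (Fin.cons n (x - y)) =
        ∫ t, t ^ n.natAbs ∂μ := by
  classical
  obtain ⟨μ, hfin, hsupp, hmom⟩ := exists_hausdorffMeasure_axisForm hβ hm 0 (fun a : s => v a)
    (fun a : s => (Fin.cons 0 (a : Fin d' → ℤ) : Site (d' + 1))) (fun a => by simp)
  refine ⟨μ, hfin, hsupp, fun n => ?_⟩
  -- the form of the item, as a function of `n : ℤ`
  set Q : ℤ → ℝ := fun k => ∑ x ∈ s, ∑ y ∈ s, v x * v y * twoPointPlus (d' + 1) β (Fin.cons k (x - y)) with hQ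
  -- (1) for `m : ℕ` it is the axis form at the sites `(0, x)`
  have hQaxis : ∀ m : ℕ, Q m = axisForm β 0 (fun a : s => v a)
      (fun a : s => (Fin.cons 0 (a : Fin d' → ℤ) : Site (d' + 1))) m := by
    intro m
    symm
    calc axisForm β 0 (fun a : s => v a) (fun a : s => (Fin.cons 0 (a : Fin d' → ℤ) : Site (d' + 1))) m
        = ∑ a : s, ∑ b : s, v b * v a * twoPointPlus (d' + 1) β (Fin.cons (m : ℤ) ((b : Fin d' → ℤ) - a)) := by
          unfold axisForm
          refine Finset.sum_congr rfl fun a _ => Finset.sum_congr rfl fun b _ => ?_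
          rw [cons_zero_sub_cons_zero_add_single]
          ring
      _ = ∑ b : s, ∑ a : s, v b * v a * twoPointPlus (d' + 1) β (Fin.cons (m : ℤ) ((b : Fin d' → ℤ) - a)) :=
          Finset.sum_comm
      _ = Q m := by
          simp only [hQ]
          rw [← Finset.sum_coe_sort s (fun x => ∑ y ∈ s, v x * v y * twoPointPlus (d' + 1) β (Fin.cons (m : ℤ) (x - y)))]
          exact Finset.sum_congr rfl fun b _ =>
            Finset.sum_coe_sort s (fun y => v b * v y * twoPointPlus (d' + 1) β (Fin.cons (m : ℤ) ((b : Fin d' → ℤ) - y)))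
  -- (2) evenness in `n`
  have hQeven : ∀ k : ℤ, Q (-k) = Q k := by
    intro k
    simp only [hQ]
    rw [Finset.sum_comm]
    refine Finset.sum_congr rfl fun y _ => Finset.sum_congr rfl fun x _ => ?_
    rw [← twoPointPlus_neg β (Fin.cons k (y - x)), neg_cons, neg_sub]
    ring
  have hQabs : Q n = Q (n.natAbs : ℕ) := by
    rcases Int.natAbs_eq n with h | h
    · rw [← h]
    · conv_lhs => rw [h]
      rw [hQeven]
  show Q n = _
  rw [hQabs, hQaxis, hmom]

end MixedSpectral

/-! ### Part 5. The item -/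

open Literature.Probability.LatticeModels in
/-- **Item `MixedSpectralRepresentation` (route `PerfectScreening`, stmt-CriticalPhenomena-13893) —
PROVED.** For every finitely supported real `v` on the plane `ℤ²` (support `s`) the axial form
`Q_v(n) = ∑_{x,y ∈ s} v_x v_y ⟨σ₀ σ_{(n, x − y)}⟩⁺_{β_c(3)}` of the critical two-point function of the
nearest-neighbour Ising model on `ℤ³` is a Hausdorff moment sequence: there is a finite positive
measure `μ_v` carried by `[0, 1]` with `Q_v(n) = ∫ λ^{|n|} dμ_v` for all `n ∈ ℤ` (Aizenman–Duminil-Copin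
2021, Prop. 5.3 / App. Prop. 8.6, quadratic-form version; transfer-matrix spectral representation
on tori, `m*(β_c(3)) = 0` by `spontaneousMagnetization_criticalBeta_eq_zero_holds`, `β_c(3) > 0` by
`criticalBeta_pos_holds`, moment / weak-compactness limit).
[cite: AizenmanDuminilCopinAnnals2021, Appendix §8.3 Prop. 8.6 (= Prop. 5.3)] -/
theorem mixedSpectralRepresentation_proof :
    Summit.CriticalPhenomena.Ising3DConformalLimit.Theses.PerfectScreening.MixedSpectralRepresentation := by
  unfold Summit.CriticalPhenomena.Ising3DConformalLimit.Theses.PerfectScreening.MixedSpectralRepresentation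
  intro s v
  have hβ : 0 < criticalBeta (2 + 1) := criticalBeta_pos_holds (d := 2 + 1) (by norm_num)
  have hm : spontaneousMagnetization (2 + 1) (criticalBeta (2 + 1)) = 0 :=
    spontaneousMagnetization_criticalBeta_eq_zero_holds (d := 2 + 1) (by norm_num)
  exact MixedSpectral.exists_hausdorffMeasure_consForm hβ hm s v

end Summit.CriticalPhenomena.Ising3DConformalLimit.Theorems

end
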